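import Literature.AlgebraicGeometry.ShimuraVarieties.UnitaryCurveAuxiliaryIntegralActionV      -- ★ E1 7b: the reading currency `hρ`, `coe_auxRepV_scalar_eq_map`, `resMatrix_map_algebraMap`
import Literature.AlgebraicGeometry.ShimuraVarieties.UnitaryAuxiliarySymplecticAdelic          -- ★ `ratFiniteAdeleTensorEquiv_symm_conjFiniteAdele`
import Literature.NumberTheory.Adeles.IntegralAdelesIntegralBasis                              -- ★ `repr_ratFiniteAdeleTensorEquiv_symm_mem_integralFiniteAdeles` (`𝓞̂_M = ẑ ⊗ 𝓞_M`)
import Literature.NumberTheory.Adeles.RatFiniteIdeleCongruenceClasses                          -- ★ `mem_integralAdeles_iff_mem_integralFiniteAdeles` (the two spellings of `ẑ`)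
import Literature.NumberTheory.AdelicBaseChange.AutomorphicCompat                              -- ★ `finiteAdeleRing_mapSemialgHom_apply_eq_baseChange`
import HarnessLib

/-!
# Frame arithmetic of the TORUS LEG `ũ_β(1, z)`: multiplier, `ẑ`-integrality and principal congruence of a central idèle read in an
# `𝓞_M`-stable symplectic frame ([Shimura 1998] §18.6; [Milne 2005] §6, Def. 12.8; [Lan 2013] §1.3.6)

Topic `AlgebraicGeometry/ShimuraVarieties`; namespace `Literature.AlgebraicGeometry.ShimuraVarieties.UnitaryCurve.AuxV`.  THEOREMS ONLY (no
definition, no named fact, no instance, no notation, no `sorry`; net debt 0).  Cell `hodgecm-mathlib`, FLOOR 0, P6 «MOD programme» (crux hLiu418 =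
stmt-HodgeConjecture-24832, `--supports`), X-LEAF sheet line, organ «TORUS-LEG FRAME ARITHMETIC» for the (S8) closer of `stub_ESHEET`: the
hypotheses `hT` (integrality of `ν·r′⁻¹r`), `hk` (`r⁻¹r′ ≡ 1 (mod N)`) and `hμ` (multiplier of `r′⁻¹r`) of the one-call zip ★
`AbelianSchemeOver.LevelStructure.isSymplecticLiftable_of_markedComplexFibre_comp` when `r′⁻¹r = ũ_β(1, z)` is the TORUS LEG of the E1 carrier ★
`auxToGspFinV` at a central idèle `z ∈ T₀(M)(𝔸_f)` (the Serre twist `A ↦ A ⊗ 𝔞⁻¹`, `[z] = 𝔞⁻¹`, of the sheet law; (S2a) ★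
`exists_siegelRecipDatum_centralTwist_at`, (S2b) ★ `SiegelAdelicMarking.exists_marking_of_idealKernel`).

SETTING ([Milne2005ShimuraVarieties] §6 p. 67 and §8 p. 81; [Deligne1979ShimuraVarieties] Prop. 2.3.10): `Fr : SymplecticFrameV M j H ξ g δ` an E1 symplectic frame
of `V_M = M^n` over `ℚ` and `ρ : 𝓞 M →+* M_{2g}(ℤ)` an INTEGRAL READING of the scalars in the frame (`(ρ b)_ℚ = P·res(b•1)·Q`, the output of ★
`exists_symplecticFrameV_integralAction`, the `ρ₀`-conjunct of the X-leaf pin `IsChartOfFrame`).  For `y ∈ 𝔸_{ℚ,f} ⊗_ℚ M` the FRAMED SCALAR is the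
matrix `P_𝔸·res(y•1)·Q_𝔸 ∈ M_{2g}(𝔸_{ℚ,f})`; the torus leg `ũ_β(1, z)` is the framed scalar of `e⁻¹(z)` (`e : 𝔸_{ℚ,f} ⊗ M ≅ 𝔸_{M,f}`, ★ `ratFiniteAdeleTensorEquiv`).

* §1 the framed scalar is `𝔸_{ℚ,f}`-linear, unital and additive in `y` (`frameScalar_*`), and equals `(ρ b)` on `1 ⊗ b` (`frameScalar_one_tmul_eq_map_reading`);
  the torus leg is the framed scalar of `e⁻¹ z` (`coe_auxToGspFinV_one_eq_frameScalar`).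
* §2 **`𝓞̂_M` ACTS `ẑ`-INTEGRALLY IN THE FRAME** (`frameScalar_integral_of_mem_integralFiniteAdeles`): `𝓞̂_M = ẑ ⊗_ℤ 𝓞_M` in an integral basis (★
  `repr_ratFiniteAdeleTensorEquiv_symm_mem_integralFiniteAdeles`) and each `ρ(β_k)` is an integer matrix — Shimura՚s «`a x ⊂ x` for `a ∈ 𝔤`» read adelically.
* §3 HEADS for the zip, in its spelling `FiniteAdeleRing.integralAdeles (𝓞 ℚ) ℚ`: (hT) `auxToGspFinV_one_integral_of_natCast_mul_mem` — if `ν·z ∈ 𝓞̂_M` (`ν ∈ ℕ`)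
  then `ν·ũ_β(1,z)` is `ẑ`-integral; (hk) `auxToGspFinV_one_sub_one_of_sub_one_eq_natCast_mul` — if `z − 1 = N·u` with `u ∈ 𝓞̂_M` then `ũ_β(1,z) − 1 ∈ N·M_{2g}(ẑ)`;
  (hμ) `isMultiplier_auxToGspFinV` — `ũ_β(a, z)` has multiplier the rational idèle `q` with `z·z̄ = q` (the torus condition, made explicit).

## References
* [Shimura1998] G. Shimura, *Abelian Varieties with Complex Multiplication and Modular Functions* (1998), §18.3 pp. 122–123, §18.6 pp. 124–127.
* [Milne2005ShimuraVarieties] J. S. Milne, *Introduction to Shimura varieties* (2005), §6 p. 67 (ν(g)), §8 p. 81, Def. 12.8 (60)–(62) p. 114.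
* [Lan2013PELCompactifications] K.-W. Lan, *Arithmetic compactifications of PEL-type Shimura varieties* (2013), §1.3.6 Lemma 1.3.6.5 (p. 81), Cor. 1.3.6.7 (p. 82).
* [Deligne1979ShimuraVarieties] P. Deligne, *Variétés de Shimura* (1979), Prop. 2.3.10 (PDF p. 32 of Milne's translation).
* [CasselsFrohlichANT1967] J. W. S. Cassels, A. Fröhlich (eds.), *Algebraic Number Theory* (1967), Ch. II §11, §14 Lemma (14.2).
HC_CM is proved only modulo the printed citations (2 remaining named inputs hLiu418 24832, h413 24833) until rung 0 closes — count-neutral.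
-/

set_option autoImplicit false

noncomputable section

open Matrix NumberField IsDedekindDomain
open scoped TensorProduct
open Literature.AlgebraicGeometry.ModuliOfAbelianVarieties
open Literature.NumberTheory.Automorphic (integralFiniteAdeles mem_integralFiniteAdeles_iff)

namespace Literature.AlgebraicGeometry.ShimuraVarieties

namespace UnitaryCurve

namespace AuxV

open Literature.AlgebraicGeometry.ShimuraVarieties.UnitaryCanonicalModel.Aux (ratBasis torusFinAdelic torusToTensorFin conjR
  ratFiniteAdeleTensorEquiv_symm_conjFiniteAdele)
open Literature.AlgebraicGeometry.ShimuraVarieties.UnitaryCurve.Aux (unitaryToTensorFin unitaryToTensorFin_unitary)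
open Literature.NumberTheory.Automorphic Literature.NumberTheory.Automorphic.UnitaryGroup
open Literature.NumberTheory.ComplexMultiplication (ratFiniteAdeleTensorEquiv ratFiniteAdeleTensorEquiv_tmul ratFiniteAdeleTensorEquiv_symm_algebraMap)
open Literature.NumberTheory.Adeles (repr_ratFiniteAdeleTensorEquiv_symm_mem_integralFiniteAdeles mem_integralAdeles_iff_mem_integralFiniteAdeles)
open Literature.NumberTheory.AdelicBaseChange (finiteAdeleRing_mapSemialgHom_apply_eq_baseChange)

/-! ### §1. The framed scalar `P_𝔸·res(y•1)·Q_𝔸` and the torus leg -/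

section FrameScalar

/-- Restriction of scalars is linear over the base ring: `res_b(r • A) = r • res_b(A)`. [cite: Deligne1971TravauxShimura, 4.9 p. 147] -/
private theorem resMatrix_smul' {R S : Type} [CommRing R] [CommRing S] [Algebra R S] {κ : Type} [Fintype κ] [DecidableEq κ]
    {m : Type} [Fintype m] [DecidableEq m] (b : Module.Basis κ R S) (r : R) (A : Matrix m m S) :
    resMatrix b (r • A) = r • resMatrix b A := by
  ext ⟨i, k⟩ ⟨i', l⟩
  simp only [resMatrix_apply, Matrix.smul_apply, smul_mul_assoc, map_smul, Finsupp.smul_apply]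

variable {L : Type} [Field L] {M : Type} [Field M] [NumberField M] [IsCMField M]
  {j : L →+* M} {n : ℕ} {H : Matrix (Fin n) (Fin n) L} {ξ : M} {g : ℕ} {δ : Fin g → ℕ}

/-- The framed scalar is unital: `P_𝔸·res(1•1)·Q_𝔸 = 1`. [cite: Milne2005ShimuraVarieties, §6 p. 67] -/
theorem frameScalar_one (Fr : SymplecticFrameV M j H ξ g δ) :
    framePVR finAdeleQ Fr * resMatrix (m := Fin n) (Algebra.TensorProduct.basis finAdeleQ (ratBasis M))
        ((1 : finAdeleQ ⊗[ℚ] M) • (1 : Matrix (Fin n) (Fin n) (finAdeleQ ⊗[ℚ] M))) * frameQVR finAdeleQ Fr = 1 := by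
  rw [one_smul, map_one, Matrix.mul_one, framePVR_mul_frameQVR]

/-- The framed scalar is additive in the scalar. [cite: Milne2005ShimuraVarieties, §6 p. 67] -/
theorem frameScalar_add (Fr : SymplecticFrameV M j H ξ g δ) (y y' : finAdeleQ ⊗[ℚ] M) :
    framePVR finAdeleQ Fr * resMatrix (m := Fin n) (Algebra.TensorProduct.basis finAdeleQ (ratBasis M))
        ((y + y') • (1 : Matrix (Fin n) (Fin n) (finAdeleQ ⊗[ℚ] M))) * frameQVR finAdeleQ Fr =
      framePVR finAdeleQ Fr * resMatrix (m := Fin n) (Algebra.TensorProduct.basis finAdeleQ (ratBasis M))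
          (y • (1 : Matrix (Fin n) (Fin n) (finAdeleQ ⊗[ℚ] M))) * frameQVR finAdeleQ Fr +
        framePVR finAdeleQ Fr * resMatrix (m := Fin n) (Algebra.TensorProduct.basis finAdeleQ (ratBasis M))
          (y' • (1 : Matrix (Fin n) (Fin n) (finAdeleQ ⊗[ℚ] M))) * frameQVR finAdeleQ Fr := by
  rw [add_smul, map_add, Matrix.mul_add, Matrix.add_mul]

/-- The framed scalar is subtractive in the scalar. [cite: Milne2005ShimuraVarieties, §6 p. 67] -/
theorem frameScalar_sub (Fr : SymplecticFrameV M j H ξ g δ) (y y' : finAdeleQ ⊗[ℚ] M) :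
    framePVR finAdeleQ Fr * resMatrix (m := Fin n) (Algebra.TensorProduct.basis finAdeleQ (ratBasis M))
        ((y - y') • (1 : Matrix (Fin n) (Fin n) (finAdeleQ ⊗[ℚ] M))) * frameQVR finAdeleQ Fr =
      framePVR finAdeleQ Fr * resMatrix (m := Fin n) (Algebra.TensorProduct.basis finAdeleQ (ratBasis M))
          (y • (1 : Matrix (Fin n) (Fin n) (finAdeleQ ⊗[ℚ] M))) * frameQVR finAdeleQ Fr -
        framePVR finAdeleQ Fr * resMatrix (m := Fin n) (Algebra.TensorProduct.basis finAdeleQ (ratBasis M))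
          (y' • (1 : Matrix (Fin n) (Fin n) (finAdeleQ ⊗[ℚ] M))) * frameQVR finAdeleQ Fr := by
  rw [sub_smul, map_sub, Matrix.mul_sub, Matrix.sub_mul]

/-- The framed scalar is `𝔸_{ℚ,f}`-linear: `P_𝔸·res((r•y)•1)·Q_𝔸 = r • (P_𝔸·res(y•1)·Q_𝔸)` (★ `resMatrix_smul`). [cite: Deligne1971TravauxShimura, 4.9 p. 147] -/
theorem frameScalar_smul (Fr : SymplecticFrameV M j H ξ g δ) (r : finAdeleQ) (y : finAdeleQ ⊗[ℚ] M) :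
    framePVR finAdeleQ Fr * resMatrix (m := Fin n) (Algebra.TensorProduct.basis finAdeleQ (ratBasis M))
        ((r • y) • (1 : Matrix (Fin n) (Fin n) (finAdeleQ ⊗[ℚ] M))) * frameQVR finAdeleQ Fr =
      r • (framePVR finAdeleQ Fr * resMatrix (m := Fin n) (Algebra.TensorProduct.basis finAdeleQ (ratBasis M))
          (y • (1 : Matrix (Fin n) (Fin n) (finAdeleQ ⊗[ℚ] M))) * frameQVR finAdeleQ Fr) := by
  rw [smul_assoc, resMatrix_smul', Matrix.mul_smul, Matrix.smul_mul]

/-- **On `1 ⊗ b` the framed scalar is the base change of the rational frame matrix `P·res(b•1)·Q`** (★ `resMatrix_map_algebraMap`).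
[cite: Milne2005ShimuraVarieties, §6 p. 67, §8 p. 81] -/
theorem frameScalar_one_tmul (Fr : SymplecticFrameV M j H ξ g δ) (b : M) :
    framePVR finAdeleQ Fr * resMatrix (m := Fin n) (Algebra.TensorProduct.basis finAdeleQ (ratBasis M))
        (((1 : finAdeleQ) ⊗ₜ[ℚ] b) • (1 : Matrix (Fin n) (Fin n) (finAdeleQ ⊗[ℚ] M))) * frameQVR finAdeleQ Fr =
      (framePV Fr * resMatrix (m := Fin n) (ratBasis M) (b • (1 : Matrix (Fin n) (Fin n) M)) * frameQV Fr).map (algebraMap ℚ finAdeleQ) := by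
  rw [Matrix.map_mul, Matrix.map_mul, framePVR, frameQVR, resMatrix_map_algebraMap,
    Matrix.map_smul' _ _ _ (map_mul (Algebra.TensorProduct.includeRight : M →ₐ[ℚ] finAdeleQ ⊗[ℚ] M)),
    Matrix.map_one _ (map_zero _) (map_one _), Algebra.TensorProduct.includeRight_apply]

/-- **On `1 ⊗ b`, `b ∈ 𝓞_M`, the framed scalar is the INTEGER matrix `ρ b`** read in `𝔸_{ℚ,f}` (the reading identity `(ρ b)_ℚ = P·res(b•1)·Q`).
[cite: Kottwitz1992, §5 p. 390] [cite: Milne2005ShimuraVarieties, §8 p. 81] -/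
theorem frameScalar_one_tmul_eq_map_reading (Fr : SymplecticFrameV M j H ξ g δ) (ρ : 𝓞 M →+* Matrix (Fin g ⊕ Fin g) (Fin g ⊕ Fin g) ℤ)
    (hρ : ∀ b : 𝓞 M, (ρ b).map (Int.cast : ℤ → ℚ) =
      framePV Fr * resMatrix (m := Fin n) (ratBasis M) (((b : 𝓞 M) : M) • (1 : Matrix (Fin n) (Fin n) M)) * frameQV Fr) (b : 𝓞 M) :
    framePVR finAdeleQ Fr * resMatrix (m := Fin n) (Algebra.TensorProduct.basis finAdeleQ (ratBasis M))
        (((1 : finAdeleQ) ⊗ₜ[ℚ] ((b : 𝓞 M) : M)) • (1 : Matrix (Fin n) (Fin n) (finAdeleQ ⊗[ℚ] M))) * frameQVR finAdeleQ Fr =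
      (ρ b).map (Int.cast : ℤ → finAdeleQ) := by
  rw [frameScalar_one_tmul, ← hρ b, Matrix.map_map]
  congr 1
  funext z
  simp only [Function.comp_apply, map_intCast]

variable [NumberField L] [IsCMField L]

/-- **The torus leg is the framed scalar of `e⁻¹ z`**: `ũ_β(1, z) = P_𝔸·res((e⁻¹ z)•1)·Q_𝔸` as matrices (`e = ratFiniteAdeleTensorEquiv M`; the unitary
coordinate is `1`). [cite: Deligne1979ShimuraVarieties, Prop. 2.3.10 (PDF p. 32)] [cite: Milne2005ShimuraVarieties, Def. 12.8 (60)–(62) p. 114] -/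
theorem coe_auxToGspFinV_one_eq_frameScalar (Fr : SymplecticFrameV M j H ξ g δ) (z : ↥(torusFinAdelic M)) :
    ((auxToGspFinV Fr (1, z) : GL (Fin g ⊕ Fin g) finAdeleQ) : Matrix (Fin g ⊕ Fin g) (Fin g ⊕ Fin g) finAdeleQ) =
      framePVR finAdeleQ Fr * resMatrix (m := Fin n) (Algebra.TensorProduct.basis finAdeleQ (ratBasis M))
        (((ratFiniteAdeleTensorEquiv M).symm ((z : (FiniteAdeleRing (𝓞 M) M)ˣ) : FiniteAdeleRing (𝓞 M) M)) •
          (1 : Matrix (Fin n) (Fin n) (finAdeleQ ⊗[ℚ] M))) * frameQVR finAdeleQ Fr := by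
  rw [coe_auxToGspFinV, map_one, auxRepV, MonoidHom.comp_apply, MonoidHom.comp_apply, coe_conjRect, coe_resGL, coe_blockGLV,
    Units.val_one]
  rfl

end FrameScalar

/-! ### §2. Integral adèles of `M` act `ẑ`-integrally in an `𝓞_M`-stable frame -/

section Integral

variable {L : Type} [Field L] {M : Type} [Field M] [NumberField M] [IsCMField M]
  {j : L →+* M} {n : ℕ} {H : Matrix (Fin n) (Fin n) L} {ξ : M} {g : ℕ} {δ : Fin g → ℕ}
  (Fr : SymplecticFrameV M j H ξ g δ) (ρ : 𝓞 M →+* Matrix (Fin g ⊕ Fin g) (Fin g ⊕ Fin g) ℤ)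
  (hρ : ∀ b : 𝓞 M, (ρ b).map (Int.cast : ℤ → ℚ) =
    framePV Fr * resMatrix (m := Fin n) (ratBasis M) (((b : 𝓞 M) : M) • (1 : Matrix (Fin n) (Fin n) M)) * frameQV Fr)

include hρ

/-- **`𝓞̂_M` ACTS `ẑ`-INTEGRALLY IN THE FRAME**: for `u ∈ 𝓞̂_M` (integral at every place) the framed scalar `P_𝔸·res((e⁻¹ u)•1)·Q_𝔸` has entries in
`ẑ` — `e⁻¹ u = Σ_k c_k • (1 ⊗ β_k)` with `c_k ∈ ẑ` in the integral basis `β` (★ `repr_ratFiniteAdeleTensorEquiv_symm_mem_integralFiniteAdeles`) and each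
`P·res(β_k•1)·Q = ρ(β_k)` is an integer matrix.  Shimura՚s «the lattice `𝔞x` of `A ⊗ 𝔞⁻¹`» needs exactly this: `𝓞_M`-stable `ℤ`-lattices are
`𝓞̂_M`-stable adelically. [cite: Shimura1998, §18.3 pp. 122–123] [cite: CasselsFrohlichANT1967, Ch. II §11 and §14 Lemma (14.2)] [cite: Kottwitz1992, §5 p. 390] -/
theorem frameScalar_integral_of_mem_integralFiniteAdeles {u : FiniteAdeleRing (𝓞 M) M} (hu : u ∈ integralFiniteAdeles M) :
    ∀ i k, (framePVR finAdeleQ Fr * resMatrix (m := Fin n) (Algebra.TensorProduct.basis finAdeleQ (ratBasis M))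
        (((ratFiniteAdeleTensorEquiv M).symm u) • (1 : Matrix (Fin n) (Fin n) (finAdeleQ ⊗[ℚ] M))) * frameQVR finAdeleQ Fr) i k ∈
      integralFiniteAdeles ℚ := by
  classical
  intro i k
  -- expand `e⁻¹ u` in the integral basis `1 ⊗ β_l`
  set B := Algebra.TensorProduct.basis finAdeleQ (integralBasis M) with hB
  set c : Module.Free.ChooseBasisIndex ℤ (𝓞 M) → finAdeleQ := fun l => B.repr ((ratFiniteAdeleTensorEquiv M).symm u) l with hc
  have hsum : (ratFiniteAdeleTensorEquiv M).symm u = ∑ l, c l • (((1 : finAdeleQ) ⊗ₜ[ℚ] ((RingOfIntegers.basis M l : 𝓞 M) : M))) := by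
    conv_lhs => rw [← B.sum_repr ((ratFiniteAdeleTensorEquiv M).symm u)]
    refine Finset.sum_congr rfl fun l _ => ?_
    rw [hB, Algebra.TensorProduct.basis_apply, integralBasis_apply]
  have hmat : framePVR finAdeleQ Fr * resMatrix (m := Fin n) (Algebra.TensorProduct.basis finAdeleQ (ratBasis M))
        (((ratFiniteAdeleTensorEquiv M).symm u) • (1 : Matrix (Fin n) (Fin n) (finAdeleQ ⊗[ℚ] M))) * frameQVR finAdeleQ Fr =
      ∑ l, c l • (ρ (RingOfIntegers.basis M l)).map (Int.cast : ℤ → finAdeleQ) := by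
    rw [hsum, Finset.sum_smul, map_sum, Matrix.mul_sum, Matrix.sum_mul]
    refine Finset.sum_congr rfl fun l _ => ?_
    rw [frameScalar_smul, frameScalar_one_tmul_eq_map_reading Fr ρ hρ]
  rw [hmat, Matrix.sum_apply]
  refine sum_mem fun l _ => ?_
  rw [Matrix.smul_apply, Matrix.map_apply, smul_eq_mul]
  exact mul_mem (repr_ratFiniteAdeleTensorEquiv_symm_mem_integralFiniteAdeles M hu l) (intCast_mem _ _)

end Integral

/-! ### §3. Heads for the zip: (hT) integrality of `ν·ũ_β(1,z)`, (hk) `ũ_β(1,z) ≡ 1 (mod N)`, (hμ) the multiplier of `ũ_β(a,z)` -/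

section Heads

variable {L : Type} [Field L] [NumberField L] [IsCMField L] {M : Type} [Field M] [NumberField M] [IsCMField M]
  {j : L →+* M} {n : ℕ} {H : Matrix (Fin n) (Fin n) L} {ξ : M} {g : ℕ} {δ : Fin g → ℕ}

omit [IsCMField M] in
/-- `e⁻¹(N·y) = N • e⁻¹(y)` for a natural number `N` (`e⁻¹` is a ring map and `N = N ⊗ 1`). [cite: CasselsFrohlichANT1967, Ch. II §14 Lemma (14.2)] -/
theorem ratFiniteAdeleTensorEquiv_symm_natCast_mul (N : ℕ) (y : FiniteAdeleRing (𝓞 M) M) :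
    (ratFiniteAdeleTensorEquiv M).symm ((N : FiniteAdeleRing (𝓞 M) M) * y) = (N : finAdeleQ) • (ratFiniteAdeleTensorEquiv M).symm y := by
  rw [map_mul, map_natCast, ← map_natCast (algebraMap finAdeleQ (finAdeleQ ⊗[ℚ] M)) N, ← Algebra.smul_def]

/-- **(hT) `ν·ũ_β(1, z)` IS `ẑ`-INTEGRAL WHEN `ν·z ∈ 𝓞̂_M`** (`ν ∈ ℕ`; for the Serre twist: `[z] = 𝔞⁻¹` and `ν ∈ 𝔞𝔞̄ ⊆ 𝔞`, so `ν z ∈ 𝓞̂_M`): in the zip՚s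
spelling, `(ν : 𝔸_{ℚ,f}) * ũ_β(1,z)_{ik} ∈ FiniteAdeleRing.integralAdeles (𝓞 ℚ) ℚ` for all `i k`.
[cite: Shimura1998, §18.6 pp. 124–127] [cite: Lan2013PELCompactifications, §1.3.6 Lemma 1.3.6.5 (p. 81)] -/
theorem auxToGspFinV_one_integral_of_natCast_mul_mem (Fr : SymplecticFrameV M j H ξ g δ)
    (ρ : 𝓞 M →+* Matrix (Fin g ⊕ Fin g) (Fin g ⊕ Fin g) ℤ)
    (hρ : ∀ b : 𝓞 M, (ρ b).map (Int.cast : ℤ → ℚ) =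
      framePV Fr * resMatrix (m := Fin n) (ratBasis M) (((b : 𝓞 M) : M) • (1 : Matrix (Fin n) (Fin n) M)) * frameQV Fr)
    (z : ↥(torusFinAdelic M)) (ν : ℕ)
    (hνz : (ν : FiniteAdeleRing (𝓞 M) M) * ((z : (FiniteAdeleRing (𝓞 M) M)ˣ) : FiniteAdeleRing (𝓞 M) M) ∈ integralFiniteAdeles M) :
    ∀ i k, (ν : finAdeleQ) *
        ((auxToGspFinV Fr (1, z) : GL (Fin g ⊕ Fin g) finAdeleQ) : Matrix (Fin g ⊕ Fin g) (Fin g ⊕ Fin g) finAdeleQ) i k ∈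
      FiniteAdeleRing.integralAdeles (𝓞 ℚ) ℚ := by
  intro i k
  have h := frameScalar_integral_of_mem_integralFiniteAdeles Fr ρ hρ hνz i k
  rw [ratFiniteAdeleTensorEquiv_symm_natCast_mul, frameScalar_smul, Matrix.smul_apply, smul_eq_mul] at h
  rw [mem_integralAdeles_iff_mem_integralFiniteAdeles, coe_auxToGspFinV_one_eq_frameScalar]
  exact h

/-- **(hk) `ũ_β(1, z) ≡ 1 (mod N·M_{2g}(ẑ))` WHEN `z ≡ 1 (mod N·𝓞̂_M)`**: if `z − 1 = N·u` with `u ∈ 𝓞̂_M` then every entry of `ũ_β(1,z) − 1` is `N·t` with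
`t ∈ ẑ` — the zip՚s `hk` (level structures are read modulo `N`). [cite: Shimura1998, §18.6 pp. 124–127] [cite: Lan2013PELCompactifications, §1.3.6 Cor. 1.3.6.7 (p. 82)] -/
theorem auxToGspFinV_one_sub_one_of_sub_one_eq_natCast_mul (Fr : SymplecticFrameV M j H ξ g δ)
    (ρ : 𝓞 M →+* Matrix (Fin g ⊕ Fin g) (Fin g ⊕ Fin g) ℤ)
    (hρ : ∀ b : 𝓞 M, (ρ b).map (Int.cast : ℤ → ℚ) =
      framePV Fr * resMatrix (m := Fin n) (ratBasis M) (((b : 𝓞 M) : M) • (1 : Matrix (Fin n) (Fin n) M)) * frameQV Fr)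
    (z : ↥(torusFinAdelic M)) (N : ℕ) {u : FiniteAdeleRing (𝓞 M) M} (hu : u ∈ integralFiniteAdeles M)
    (hz : ((z : (FiniteAdeleRing (𝓞 M) M)ˣ) : FiniteAdeleRing (𝓞 M) M) - 1 = (N : FiniteAdeleRing (𝓞 M) M) * u) :
    ∀ i k, ∃ t ∈ FiniteAdeleRing.integralAdeles (𝓞 ℚ) ℚ,
      (((auxToGspFinV Fr (1, z) : GL (Fin g ⊕ Fin g) finAdeleQ) : Matrix (Fin g ⊕ Fin g) (Fin g ⊕ Fin g) finAdeleQ) - 1) i k =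
        (N : finAdeleQ) * t := by
  intro i k
  refine ⟨(framePVR finAdeleQ Fr * resMatrix (m := Fin n) (Algebra.TensorProduct.basis finAdeleQ (ratBasis M))
      (((ratFiniteAdeleTensorEquiv M).symm u) • (1 : Matrix (Fin n) (Fin n) (finAdeleQ ⊗[ℚ] M))) * frameQVR finAdeleQ Fr) i k,
    (mem_integralAdeles_iff_mem_integralFiniteAdeles _).2 (frameScalar_integral_of_mem_integralFiniteAdeles Fr ρ hρ hu i k), ?_⟩
  have hz' : (ratFiniteAdeleTensorEquiv M).symm ((z : (FiniteAdeleRing (𝓞 M) M)ˣ) : FiniteAdeleRing (𝓞 M) M) - 1 =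
      (N : finAdeleQ) • (ratFiniteAdeleTensorEquiv M).symm u := by
    rw [← ratFiniteAdeleTensorEquiv_symm_natCast_mul, ← hz, map_sub, map_one]
  rw [coe_auxToGspFinV_one_eq_frameScalar, ← frameScalar_one Fr, ← frameScalar_sub, hz', frameScalar_smul, Matrix.smul_apply,
    smul_eq_mul]

/-- **(hμ) THE MULTIPLIER OF `ũ_β(a, z)` IS THE RATIONAL IDÈLE `q` WITH `z·z̄ = q`** (the torus condition `z ∈ T₀(M)(𝔸_f)` made explicit; the unitary factor
has multiplier `1`): `IsMultiplier E_δ (ũ_β(a, z)) q` (★ `isMultiplier_auxRepV`). [cite: Milne2005ShimuraVarieties, §6 p. 67 (ν(g))] [cite: RapoportSmithlingZhang2020Diagonal, Remark 3.2 (ii)(iii) pp. 9–10] -/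
theorem isMultiplier_auxToGspFinV (Fr : SymplecticFrameV M j H ξ g δ)
    (a : ↥(finAdelic (↥(maximalRealSubfield L)) L (IsCMField.complexConj L) n H)) (z : ↥(torusFinAdelic M)) (q : finAdeleQˣ)
    (hq : ((z : (FiniteAdeleRing (𝓞 M) M)ˣ) : FiniteAdeleRing (𝓞 M) M) *
        conjFiniteAdele (↥(maximalRealSubfield M)) M (IsCMField.complexConj M) ((z : (FiniteAdeleRing (𝓞 M) M)ˣ) : FiniteAdeleRing (𝓞 M) M) =
      FiniteAdeleRing.baseChange (𝓞 ℚ) ℚ M (𝓞 M) (q : finAdeleQ)) :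
    IsMultiplier (typeFormOver δ finAdeleQ) (auxToGspFinV Fr (a, z) : GL (Fin g ⊕ Fin g) finAdeleQ) q := by
  have hcoe : (torusToTensorFin M z : finAdeleQ ⊗[ℚ] M) =
      (ratFiniteAdeleTensorEquiv M).symm ((z : (FiniteAdeleRing (𝓞 M) M)ˣ) : FiniteAdeleRing (𝓞 M) M) := rfl
  have ht : conjR M finAdeleQ (torusToTensorFin M z : finAdeleQ ⊗[ℚ] M) * (torusToTensorFin M z : finAdeleQ ⊗[ℚ] M) =
      algebraMap finAdeleQ (finAdeleQ ⊗[ℚ] M) (q : finAdeleQ) := by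
    rw [hcoe, ← ratFiniteAdeleTensorEquiv_symm_conjFiniteAdele, ← map_mul, mul_comm, hq, ← finiteAdeleRing_mapSemialgHom_apply_eq_baseChange,
      RingEquiv.symm_apply_eq, Algebra.TensorProduct.algebraMap_apply, Algebra.algebraMap_self_apply, ratFiniteAdeleTensorEquiv_tmul, map_one,
      one_mul]
  change IsMultiplier (typeFormOver δ finAdeleQ) (auxRepV finAdeleQ Fr (torusToTensorFin M z, unitaryToTensorFin M j H a)) q
  exact isMultiplier_auxRepV finAdeleQ Fr ht (unitaryToTensorFin_unitary M j H a)

end Heads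

end AuxV

end UnitaryCurve

end Literature.AlgebraicGeometry.ShimuraVarieties

end
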